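import Summits.Langlands.Langlands.Theses.SkinnerWilesDefectOne
import Summits.Langlands.Langlands.Theorems.SkinnerWilesDefectOneProModularOrdinaryClassicalGivenBianchiFiniteness

/-!
# Route `SkinnerWilesDefectOne`, crux `ProModularOrdinaryClassical` (stmt-Langlands-12921): the rev-8/9/10 EXIT —
# the crux from its open core, FIVE printed facts and crux #7, as ONE importable implication

Helper file (`--supports stmt-Langlands-12921`) of the checked skeleton
`Cruxes/ProModularOrdinaryClassical/Lines/top_degree_exact_control.lean`, rev 10 (lead prover-line-stmt-Langlands-12921-c6-0;
rev 10 = rev 9 = rev 8 re-registered).  Since rev 8 the skeleton's composition consumes only FIVE printed named facts — fact (C)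
"infinity types exist for every `GL_n` datum" (`AutomorphicRepData.exists_hasInfinityType`, Clozel 1990 §3.3, all `n`) was
dropped, the CM branch using the glue-item seat's `GivenBianchiFiniteness.cmInducedCuspidal_of_two_facts` (p112953), which
discharges (C) at `n = 2` by the tree's theorem `RegularTwistCM.exists_hasInfinityType_gl_two`.  The two landed crux-concluding
exits, however, still carry (C) for ALL `n` as a hypothesis (`proModularOrdinaryClassical_of_ordinaryFactorisationIwahoriNonCM`,
p111700: seven facts; `proModularOrdinaryClassical_of_bianchiFinite_of_ordinaryFactorisationIwahoriNonCM`, p114500: six facts +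
crux #7), and the five-fact composition of p112953 (`proModularOrdinaryClassicalGivenBianchiFiniteness_of_ordinaryFactorisation`)
concludes the GLUE ITEM `ProModularOrdinaryClassicalGivenBianchiFiniteness` (stmt-Langlands-15365), not the crux.  This file
records the crux-concluding form with the smaller trust base, so that a planner's `@[conjecture]` bridge for the open core
closes the CRUX from exactly: the bridge + the five facts + crux #7 (`BianchiCongruenceCohomologyFinite`, stmt-Langlands-15362,
taken as a hypothesis and discharged BY NAME when that item closes):

`proModularOrdinaryClassical_of_bianchiFinite_of_fiveFacts_of_ordinaryFactorisationIwahoriNonCM`: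
  `BianchiCongruenceCohomologyFinite`
  → `automorphicInduction_cyclic_cuspidal` (Arthur–Clozel Ch. 3 Thm. 6.2 / Lemma 6.4)
  → `Henniart2012_infinityType_of_automorphicInduction`
  → `hidaControl_dominantOrdinaryPoint` (Hida 1994) → `bianchi_interiorEigenclass_isCuspidal` (Harder 1987)
  → `bianchi_boundaryEigensystem_isReducible` (Harder 1987)
  → (OF_Iw-nonCM: the registered open core `stub_ordinaryFactorisationIwahoriNonCM` VERBATIM — for NON-CM `ρ`, pro-modular +
    Galois-ordinary of parallel weight `k ≥ 2` ⇒ a continuous slope-zero point of the Iwahori-level big Hecke algebra at a tame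
    level maximal above `p`, associated with `ρ`, with finite-order slot-`0` diamond character; = ordinary local–global
    compatibility for completed cohomology of `GL₂` over an imaginary quadratic field in the Galois ⇒ Hecke direction, OPEN in
    print as of 2026-08-16)
  → `ProModularOrdinaryClassical`.

Pure logic over the landed p112953 (one line); no new mathematics; no definitions.  What is NOT here: any claim on the open core
(see `Cruxes/ProModularOrdinaryClassical/OPEN-CORE-c3.md`, `PROMOTE-c4.md`, `PROMOTE-c5.md`, `CYCLE-c6.md`).
-/

noncomputable section

namespace Summit.Langlands.Langlands.Cruxes.ProModularOrdinaryClassical.TopDegreeExactControl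

set_option linter.dupNamespace false -- mandated namespace `Summit.Langlands.Langlands.Cruxes…` repeats `Langlands` (as in the sibling exit files)

open Summit.Langlands.Langlands.Theses.SkinnerWilesDefectOne
open Summit.Langlands.Langlands.Theorems.SkinnerWilesDefectOne.GivenBianchiFiniteness

/-- **The crux from its open core, five printed facts and crux #7** (skeleton rev 8/9/10 composed once, as an importable
implication): Borel–Serre finiteness for congruence subgroups of `GL₂` over imaginary quadratic fields (the route item
`BianchiCongruenceCohomologyFinite`) → cuspidal cyclic automorphic induction → Henniart's infinity type of an automorphic
induction → Hida control for dominant ordinary points → Eichler–Shimura–Harder for interior Bianchi eigenclasses → reducibility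
of boundary eigensystems → (OF_Iw-nonCM, the registered open core verbatim) → `ProModularOrdinaryClassical`.  Proof: the landed
five-fact composition `proModularOrdinaryClassicalGivenBianchiFiniteness_of_ordinaryFactorisation` (p112953) concludes
`ProModularOrdinaryClassicalGivenBianchiFiniteness = BianchiCongruenceCohomologyFinite → ProModularOrdinaryClassical`; apply it
to the first hypothesis. [folklore] -/
theorem proModularOrdinaryClassical_of_bianchiFinite_of_fiveFacts_of_ordinaryFactorisationIwahoriNonCM : Summit.Langlands.Langlands.Theses.SkinnerWilesDefectOne.BianchiCongruenceCohomologyFinite → Literature.NumberTheory.Automorphic.automorphicInduction_cyclic_cuspidal → Literature.NumberTheory.Automorphic.Henniart2012_infinityType_of_automorphicInduction → Literature.NumberTheory.Automorphic.hidaControl_dominantOrdinaryPoint → Literature.NumberTheory.Automorphic.bianchi_interiorEigenclass_isCuspidal → Literature.NumberTheory.Automorphic.bianchi_boundaryEigensystem_isReducible → (∀ (F : Type) [Field F] [NumberField F], NumberField.IsTotallyComplex F → Module.finrank ℚ F = 2 → ∀ (p : ℕ) [Fact p.Prime], p ≠ 2 → ∀ (ι : PadicAlgCl p ≃+* ℂ)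 (ρ : Literature.NumberTheory.GaloisRepresentations.FramedGaloisRep F (PadicAlgCl p) 2) (k m : ℕ), ρ.toGaloisRep.IsIrreducible → (¬ ∃ (K : Type) (_ : Field K) (_ : NumberField K) (_ : Algebra F K) (_ : Module.finrank F K = 2) (θ : Literature.NumberTheory.GaloisRepresentations.HeckeCharacter K), θ.IsAlgebraic ∧ (∃ᶠ w : IsDedekindDomain.HeightOneSpectrum (NumberField.RingOfIntegers K) in Filter.cofinite, ∃ w' : IsDedekindDomain.HeightOneSpectrum (NumberField.RingOfIntegers K), w'.asIdeal.under (NumberField.RingOfIntegers F) = w.asIdeal.under (NumberField.RingOfIntegers F) ∧ θ.valueAtUniformizer w' ≠ θ.valueAtUniformizer w) ∧ ∀ᶠ v : IsDedekindDomain.HeightOneSpectrum (NumberField.RingOfIntegers F) in Filter.cofinite, ρ.IsUnramifiedAt v ∧ ρ.HasFrobCharpolyAt v (∏ᶠ w ∈ {w : IsDedekindDomain.HeightOneSpectrum (NumberField.RingOfIntegers K) | w.under (NumberField.RingOfIntegers F) = v}, (Polynomial.X ^ w.asIdeal.inertiaDeg (NumberField.RingOfIntegers F) - Polynomial.C (ι.symm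 (θ.valueAtUniformizer w)⁻¹)))) → (∀ᶠ v in Filter.cofinite, ρ.IsUnramifiedAt v) → (∃ 𝒰 : Literature.NumberTheory.Automorphic.BigHeckeGLn.TameLevel 2 F p, 𝒰.IsPadicallyAutomorphic ρ) → 2 ≤ k → 0 < m → (∀ v : IsDedekindDomain.HeightOneSpectrum (NumberField.RingOfIntegers F), (p : NumberField.RingOfIntegers F) ∈ v.asIdeal → ρ.IsOrdinaryOfWeightAt p v k m) → ∃ 𝒰 : Literature.NumberTheory.Automorphic.BigHeckeGLn.TameLevel 2 F p, 𝒰.IsMaximalAbove ∧ ∃ y : Literature.NumberTheory.Automorphic.HidaHeckeAlgebraGLn 𝒰 →+* PadicAlgCl p, Continuous y ∧ 𝒰.IsHidaAssociated y ρ ∧ (∀ v : IsDedekindDomain.HeightOneSpectrum (NumberField.RingOfIntegers F), (p : NumberField.RingOfIntegers F) ∈ v.asIdeal → 𝒰.IsSlopeZeroAt y v) ∧ ∃ N : ℕ, 0 < N ∧ ∀ (u : NumberField.RingOfIntegers F) (û : ∀ v : IsDedekindDomain.HeightOneSpectrum (NumberField.RingOfIntegers F), (p : NumberField.RingOfIntegers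 F) ∈ v.asIdeal → (v.adicCompletionIntegers F)ˣ), (∀ (v : IsDedekindDomain.HeightOneSpectrum (NumberField.RingOfIntegers F)) (hv : (p : NumberField.RingOfIntegers F) ∈ v.asIdeal), ((û v hv : v.adicCompletionIntegers F) : v.adicCompletion F) = algebraMap F (v.adicCompletion F) (u : F)) → (∏ᶠ v : {v : IsDedekindDomain.HeightOneSpectrum (NumberField.RingOfIntegers F) // (p : NumberField.RingOfIntegers F) ∈ v.asIdeal}, y (𝒰.hidaDiamond v.2 (Pi.mulSingle (0 : Fin 2) (û v.1 v.2)))) ^ N = 1) → Summit.Langlands.Langlands.Theses.SkinnerWilesDefectOne.ProModularOrdinaryClassical :=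
  fun hBianchi hAI hHen hHC hInt hBdry hOF =>
    proModularOrdinaryClassicalGivenBianchiFiniteness_of_ordinaryFactorisation hOF hAI hHen hHC hInt hBdry hBianchi

end Summit.Langlands.Langlands.Cruxes.ProModularOrdinaryClassical.TopDegreeExactControl

end
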